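import Literature.Geometry.Lorentzian.DecaySymbolsCalculus
import Literature.Geometry.Lorentzian.RicciDecay
import Literature.Geometry.Lorentzian.RicciSection
import Literature.Geometry.Lorentzian.RicciVariationFamily
import HarnessLib

/-!
# The Ricci tensor of an asymptotically flat end in its chart: `ds² + t Ric` is asymptotically flat

Step `ha` of the Ricci variation of Schoen–Yau (Comm. Math. Phys. 65 (1979), §3, pp. 72–73),
second half: *"For `t` sufficiently small, `ds²_t` is asymptotically flat by (1.2)"* — the chart
components of `Ric` decay like `r⁻⁴` with their first two derivatives, so `h + t Ric − δ` keeps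
the expansion (1.1) with `M = 0` to second order. With the `O_k(r^a)` calculus
(`DecaySymbols.lean`, `DecaySymbolsCalculus.lean`) and the coordinate expression of the Ricci
tensor (`OpensChart.ricci_eq_coord`, `RicciDecay.lean`) this is proved here, for every real `t`:

* `AFEnd.isBigOSmooth_hCoeff_sub_innerSL` — `h − δ = o_{nh}(r^{−β})` (mass parameter `0`) makes
  `hCoeff e D − δ` a smooth symbol in `O_{nh}(r^{−β})`;
* `AFEnd.isBigOSmooth_hCoeff_apply`, `isBigOSmooth_gram_inv`, `isBigOSmooth_fderiv_hCoeff_apply`,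
  `isBigOSmooth_koszulForm`, `isBigOSmooth_fderiv_fderiv_hCoeff_apply`,
  `isBigOSmooth_fderiv_koszulForm`, `isBigOSmooth_ricciSum` — the entries `hᵢⱼ ∈ O(1)`, the
  inverse Gram matrix `g^{ij} ∈ O(1)`, `∂h`, the Koszul form `K ∈ O(r^{−β−1})`, `∂∂h`,
  `∂K ∈ O(r^{−β−2})`, and the coordinate Ricci components `∈ O(r^{−β−2})`, as smooth symbols;
* `AFEnd.ricciCoeff` — **the chart components of `Ric`** (pullback of the Ricci form along the
  inverse chart, junk `0` inside the ball; companion of `hCoeff`, `kCoeff`), with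
  `ricciCoeff_apply_eq_ricci_comap` (naturality), `ricciCoeff_eq_sum` (the coordinate expression
  in an orthonormal frame) and `isBigOSmooth_ricciCoeff` (`Ric ∈ O_k(r^{−β−2})` in the chart);
* `AFEnd.hCoeff_eq_add_ricciCoeff` — `hCoeff e D₂ = hCoeff e D + t · ricciCoeff e D` whenever
  the metric of `D₂` is `h + t Ric(h)` pointwise;
* `AFEnd.isAsymptoticallySchwarzschild_of_metric_eq_add_ricci`,
  `ricciVariation_isAsymptoticallySchwarzschild` — **`ds² + t Ric` is asymptotically
  Schwarzschildean of mass `0` to second order**, for any family of data with metric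
  `h + t Ric(h)`; consumed by the reduction of step 2 of positive mass rigidity to the elliptic
  steps of the printed proof (`exists_ricciVariation_negativeMass_of_massZero_of_elliptic_steps`,
  `RicciVariationEllipticSteps.lean`).

## References

* R. Schoen, S.-T. Yau, *On the proof of the positive mass conjecture in general relativity*,
  Comm. Math. Phys. 65 (1979) 45–76, §1 (1.1)–(1.2), §3 pp. 72–74.
* B. O'Neill, *Semi-Riemannian geometry* (1983), Ch. 3, Lemma 3.38, Prop. 3.59.
* R. Bartnik, *The mass of an asymptotically flat manifold*, CPAM 39 (1986), §1.
-/

noncomputable section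

-- instance search on the nested operator spaces of metric components and their derivatives
set_option maxSynthPendingDepth 3
set_option synthInstance.maxHeartbeats 200000

open Bundle Set Function Filter Asymptotics Bornology Topology TopologicalSpace Manifold
open scoped ContDiff Manifold

namespace Literature.Geometry.Lorentzian

namespace AFEnd

variable {X : Type} [TopologicalSpace X] [ChartedSpace E3 X] [IsManifold (𝓡 3) ∞ X]
  (e : AFEnd X) (D : InitialDataSet (𝓡 3) X)

/-! ### The metric components as a smooth symbol -/

/-- **`h − δ ∈ O_{nh}(r^{−β})`**: strong asymptotic flatness with mass parameter `0`
(`h − δ = o_{nh}(r^{−β})` in the chart) makes `hCoeff e D − δ` a smooth symbol of order `−β`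
(smooth on the exterior region by `AFEnd.ContDiffOn_hCoeff_holds`; `o` implies `O`).
Schoen–Yau 1979, (1.1)–(1.2). [cite: SchoenYauPMT1979, §1 (1.1)–(1.2)] -/
theorem isBigOSmooth_hCoeff_sub_innerSL {β γ : ℝ} {nh nk : ℕ}
    (h : IsStronglyAsymptoticallyFlatWith e D 0 β γ nh nk) :
    IsBigOSmooth nh (-β) fun y ↦ hCoeff e D y - (innerSL ℝ : E3 →L[ℝ] E3 →L[ℝ] ℝ) := by
  refine ⟨⟨e.R, (ContDiffOn_hCoeff_holds e D).sub contDiffOn_const⟩, fun m hm ↦ ?_⟩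
  have h1 := h.1 m hm
  have hfun : (fun y ↦ hCoeff e D y - (1 + 2 * (0 : ℝ) / ‖y‖) •
      (innerSL ℝ : E3 →L[ℝ] E3 →L[ℝ] ℝ)) =
      fun y ↦ hCoeff e D y - (innerSL ℝ : E3 →L[ℝ] E3 →L[ℝ] ℝ) := by
    funext y
    simp
  rw [hfun] at h1
  exact h1.isBigO

variable {k : ℕ} {β : ℝ}

/-- The entries `h(y)(v, w) = ⟪v, w⟫ + (h − δ)(y)(v, w)` are symbols of order `0` (`β ≥ 0`).
[folklore] -/
theorem isBigOSmooth_hCoeff_apply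
    (hH : IsBigOSmooth k (-β) fun y ↦ hCoeff e D y - (innerSL ℝ : E3 →L[ℝ] E3 →L[ℝ] ℝ))
    (hβ : 0 ≤ β) (v w : E3) : IsBigOSmooth k 0 fun y ↦ hCoeff e D y v w := by
  have h := (isBigOSmooth_const k (inner ℝ v w)).add
    (((hH.clm_apply_const v).clm_apply_const w).mono (by linarith : -β ≤ 0))
  refine h.congr fun y ↦ ?_
  show inner ℝ v w + (hCoeff e D y v w - inner ℝ v w) = hCoeff e D y v w
  ring

/-- The entries of `h − δ` tend to `0` at infinity (`β > 0`). [folklore] -/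
theorem tendsto_hCoeff_sub_apply
    (hH : IsBigOSmooth k (-β) fun y ↦ hCoeff e D y - (innerSL ℝ : E3 →L[ℝ] E3 →L[ℝ] ℝ))
    (hβ : 0 < β) (v w : E3) :
    Tendsto (fun y ↦ hCoeff e D y v w - inner ℝ v w) (cobounded E3) (𝓝 0) := by
  have h0 := ((hH.clm_apply_const v).clm_apply_const w).isBigO (m := 0) (Nat.zero_le _)
  simp only [norm_iteratedFDeriv_zero, Nat.cast_zero, sub_zero] at h0
  have ht : Tendsto (fun y : E3 ↦ ‖y‖ ^ (-β)) (cobounded E3) (𝓝 0) :=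
    (tendsto_rpow_neg_atTop hβ).comp tendsto_norm_cobounded_atTop
  have h := h0.norm_left.trans_tendsto ht
  rw [tendsto_zero_iff_norm_tendsto_zero]
  refine h.congr fun y ↦ ?_
  show ‖‖hCoeff e D y v w - inner ℝ v w‖‖ = ‖hCoeff e D y v w - inner ℝ v w‖
  rw [norm_norm]

/-- **The inverse Gram matrix `g^{ij}` of the end has entries in `O_k(1)`** (in an orthonormal
frame `b` of `ℝ³`; `β > 0`): the Gram matrix `(h(bᵢ, bⱼ))` is `δ + O_k(r^{−β})`, its determinant
tends to `det δ = 1`, and `isBigOSmooth_matrix_inv` applies. Schoen–Yau 1979, p. 47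
(`g^{ij} = δ^{ij} + O(r⁻¹)`); Bartnik 1986, §1. [cite: SchoenYauPMT1979, §1 p. 47] -/
theorem isBigOSmooth_gram_inv {ι : Type*} [Fintype ι] [DecidableEq ι] (b : OrthonormalBasis ι ℝ E3)
    (hH : IsBigOSmooth k (-β) fun y ↦ hCoeff e D y - (innerSL ℝ : E3 →L[ℝ] E3 →L[ℝ] ℝ))
    (hβ : 0 < β) (i j : ι) :
    IsBigOSmooth k 0 fun y ↦ (Matrix.of fun i j ↦ hCoeff e D y (b i) (b j))⁻¹ i j := by
  refine isBigOSmooth_matrix_inv (A := fun y ↦ Matrix.of fun i j ↦ hCoeff e D y (b i) (b j))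
    (fun i j ↦ e.isBigOSmooth_hCoeff_apply D hH hβ.le (b i) (b j)) ?_ i j
  -- the Gram matrix tends to `1`, hence its determinant to `1`
  have hentry : ∀ i j, Tendsto (fun y ↦ hCoeff e D y (b i) (b j)) (cobounded E3)
      (𝓝 ((1 : Matrix ι ι ℝ) i j)) := by
    intro i j
    have h := (e.tendsto_hCoeff_sub_apply D hH hβ (b i) (b j)).add_const (inner ℝ (b i) (b j))
    simp only [zero_add, sub_add_cancel] at h
    rwa [Matrix.one_apply, ← orthonormal_iff_ite.1 b.orthonormal i j]
  have hmat : Tendsto (fun y ↦ Matrix.of fun i j ↦ hCoeff e D y (b i) (b j)) (cobounded E3)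
      (𝓝 (1 : Matrix ι ι ℝ)) :=
    tendsto_pi_nhds.2 fun i ↦ tendsto_pi_nhds.2 fun j ↦ hentry i j
  have hdet := ((continuous_id.matrix_det).tendsto (1 : Matrix ι ι ℝ)).comp hmat
  rw [id_eq, Matrix.det_one] at hdet
  exact hdet

/-! ### Derivatives of the metric components -/

/-- **`∂h ∈ O(r^{−β−1})`**: the first derivatives of the metric components, evaluated on
constant vectors, are symbols of order `−β − 1`. Schoen–Yau 1979, (1.1). [cite: SchoenYauPMT1979, §1 (1.1)] -/
theorem isBigOSmooth_fderiv_hCoeff_apply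
    (hH : IsBigOSmooth (k + 1) (-β) fun y ↦ hCoeff e D y - (innerSL ℝ : E3 →L[ℝ] E3 →L[ℝ] ℝ))
    (u v w : E3) : IsBigOSmooth k (-β - 1) fun y ↦ fderiv ℝ (hCoeff e D) y u v w := by
  have h := ((hH.fderiv_apply_const u).clm_apply_const v).clm_apply_const w
  refine h.congr fun y ↦ ?_
  rw [fderiv_sub_const]

/-- **The Koszul form is `O(r^{−β−1})`**: `K(Z, Y, W)(y) = ∂_Y h(Z,W) + ∂_Z h(W,Y) − ∂_W h(Y,Z)`
on constant vectors is a symbol of order `−β − 1`. [cite: SchoenYauPMT1979, §1 (1.1)] -/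
theorem isBigOSmooth_koszulForm
    (hH : IsBigOSmooth (k + 1) (-β) fun y ↦ hCoeff e D y - (innerSL ℝ : E3 →L[ℝ] E3 →L[ℝ] ℝ))
    (Z Y W : E3) :
    IsBigOSmooth k (-β - 1) fun y ↦ OpensChart.koszulForm (hCoeff e D) y Z Y W := by
  have h := ((e.isBigOSmooth_fderiv_hCoeff_apply D hH Y Z W).add
    (e.isBigOSmooth_fderiv_hCoeff_apply D hH Z W Y)).sub
    (e.isBigOSmooth_fderiv_hCoeff_apply D hH W Y Z)
  exact h.congr fun y ↦ (OpensChart.koszulForm_apply (hCoeff e D) y Z Y W).symm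

/-- **`∂∂h ∈ O(r^{−β−2})`**: second derivatives of the metric components on constant vectors are
symbols of order `−β − 2`. Schoen–Yau 1979, (1.1). [cite: SchoenYauPMT1979, §1 (1.1)] -/
theorem isBigOSmooth_fderiv_fderiv_hCoeff_apply
    (hH : IsBigOSmooth (k + 2) (-β) fun y ↦ hCoeff e D y - (innerSL ℝ : E3 →L[ℝ] E3 →L[ℝ] ℝ))
    (u u' v w : E3) :
    IsBigOSmooth k (-β - 2) fun y ↦ fderiv ℝ (fderiv ℝ (hCoeff e D)) y u u' v w := by
  have h := ((((hH.fderiv.fderiv_apply_const u).clm_apply_const u').clm_apply_const v)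
    ).clm_apply_const w
  have heq : fderiv ℝ (fderiv ℝ fun y ↦ hCoeff e D y - (innerSL ℝ : E3 →L[ℝ] E3 →L[ℝ] ℝ)) =
      fderiv ℝ (fderiv ℝ (hCoeff e D)) := by
    have : fderiv ℝ (fun y ↦ hCoeff e D y - (innerSL ℝ : E3 →L[ℝ] E3 →L[ℝ] ℝ)) =
        fderiv ℝ (hCoeff e D) := funext fun y ↦ fderiv_sub_const _
    rw [this]
  refine (h.congr fun y ↦ ?_).mono (by linarith)
  rw [heq]

/-- **The derivatives of the Koszul form are `O(r^{−β−2})`**: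
`∂_u K(Z, Y, W) = D²h(u,Y)(Z,W) + D²h(u,Z)(W,Y) − D²h(u,W)(Y,Z)` far out (`fderiv_koszulForm_eq`
where `h` is `C²`), a symbol of order `−β − 2`. [cite: SchoenYauPMT1979, §1 (1.1)] -/
theorem isBigOSmooth_fderiv_koszulForm
    (hH : IsBigOSmooth (k + 2) (-β) fun y ↦ hCoeff e D y - (innerSL ℝ : E3 →L[ℝ] E3 →L[ℝ] ℝ))
    (u Z Y W : E3) :
    IsBigOSmooth k (-β - 2) fun y ↦
      fderiv ℝ (fun y ↦ OpensChart.koszulForm (hCoeff e D) y Z Y W) y u := by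
  have h := ((e.isBigOSmooth_fderiv_fderiv_hCoeff_apply D hH u Y Z W).add
    (e.isBigOSmooth_fderiv_fderiv_hCoeff_apply D hH u Z W Y)).sub
    (e.isBigOSmooth_fderiv_fderiv_hCoeff_apply D hH u W Y Z)
  refine h.congr_far (R₁ := e.R) fun y hy ↦ ?_
  have hG2 : ContDiffAt ℝ 2 (hCoeff e D) y :=
    (e.contDiffAt_hCoeff D hy).of_le (WithTop.coe_le_coe.mpr le_top)
  rw [fderiv_koszulForm_eq hG2]

/-! ### The Ricci components in the chart as a smooth symbol -/

/-- **The coordinate Ricci components are `O(r^{−β−2})`.** In an orthonormal frame `b` of `ℝ³`,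
the coordinate expression of `Ric(b_k, b_l)` (`OpensChart.ricci_eq_coord`:
`∑ g^{ji} [½(∂K − ∂K) − g^{ca} ¼KK + g^{ca} ¼KK]` in the components `h = hCoeff e D`) is a smooth
symbol of order `−β − 2` if `h − δ ∈ O_{k+2}(r^{−β})`, `β > 0` (`g^{ij} ∈ O(1)`,
`∂K ∈ O(r^{−β−2})`, `KK ∈ O(r^{−2β−2}) ⊆ O(r^{−β−2})`). Schoen–Yau 1979, p. 73 ("`ds²_t` is
asymptotically flat by (1.2)"). [cite: SchoenYauPMT1979, §3 p. 73] -/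
theorem isBigOSmooth_ricciSum {ι : Type*} [Fintype ι] [DecidableEq ι] (b : OrthonormalBasis ι ℝ E3)
    (hH : IsBigOSmooth (k + 2) (-β) fun y ↦ hCoeff e D y - (innerSL ℝ : E3 →L[ℝ] E3 →L[ℝ] ℝ))
    (hβ : 0 < β) (k₀ l : ι) :
    IsBigOSmooth k (-β - 2) fun y ↦
      ∑ i, ∑ j, (Matrix.of fun i j ↦ hCoeff e D y (b i) (b j))⁻¹ j i *
        (2⁻¹ * (fderiv ℝ (fun y ↦ OpensChart.koszulForm (hCoeff e D) y (b l) (b k₀) (b j)) y (b i)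
            - fderiv ℝ (fun y ↦ OpensChart.koszulForm (hCoeff e D) y (b l) (b i) (b j)) y (b k₀))
          - ∑ a, ∑ c, (Matrix.of fun i j ↦ hCoeff e D y (b i) (b j))⁻¹ c a *
              (2⁻¹ * OpensChart.koszulForm (hCoeff e D) y (b j) (b i) (b c)) *
              (2⁻¹ * OpensChart.koszulForm (hCoeff e D) y (b l) (b k₀) (b a))
          + ∑ a, ∑ c, (Matrix.of fun i j ↦ hCoeff e D y (b i) (b j))⁻¹ c a *
              (2⁻¹ * OpensChart.koszulForm (hCoeff e D) y (b j) (b k₀) (b c)) *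
              (2⁻¹ * OpensChart.koszulForm (hCoeff e D) y (b l) (b i) (b a))) := by
  have hH0 : IsBigOSmooth k (-β) fun y ↦ hCoeff e D y - (innerSL ℝ : E3 →L[ℝ] E3 →L[ℝ] ℝ) :=
    hH.of_le (by omega)
  have hH1 : IsBigOSmooth (k + 1) (-β) fun y ↦ hCoeff e D y - (innerSL ℝ : E3 →L[ℝ] E3 →L[ℝ] ℝ) :=
    hH.of_le (by omega)
  have hGi : ∀ i j, IsBigOSmooth k 0 fun y ↦ (Matrix.of fun i j ↦ hCoeff e D y (b i) (b j))⁻¹ i j :=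
    fun i j ↦ e.isBigOSmooth_gram_inv D b hH0 hβ i j
  have hK : ∀ a c d, IsBigOSmooth k (-β - 1) fun y ↦
      2⁻¹ * OpensChart.koszulForm (hCoeff e D) y (b a) (b c) (b d) :=
    fun a c d ↦ (e.isBigOSmooth_koszulForm D hH1 (b a) (b c) (b d)).const_mul 2⁻¹
  have hP : ∀ a c d f, IsBigOSmooth k (-β - 2) fun y ↦
      fderiv ℝ (fun y ↦ OpensChart.koszulForm (hCoeff e D) y (b c) (b d) (b f)) y (b a) :=
    fun a c d f ↦ e.isBigOSmooth_fderiv_koszulForm D hH (b a) (b c) (b d) (b f)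
  have hKK : ∀ (a₁ c₁ d₁ a₂ c₂ d₂ : ι) (p q : ι), IsBigOSmooth k (-β - 2) fun y ↦
      (Matrix.of fun i j ↦ hCoeff e D y (b i) (b j))⁻¹ p q *
        (2⁻¹ * OpensChart.koszulForm (hCoeff e D) y (b a₁) (b c₁) (b d₁)) *
        (2⁻¹ * OpensChart.koszulForm (hCoeff e D) y (b a₂) (b c₂) (b d₂)) := by
    intro a₁ c₁ d₁ a₂ c₂ d₂ p q
    exact (((hGi p q).mul (hK a₁ c₁ d₁)).mul (hK a₂ c₂ d₂)).mono (by linarith)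
  refine IsBigOSmooth.finset_sum _ fun i _ ↦ IsBigOSmooth.finset_sum _ fun j _ ↦ ?_
  refine ((hGi j i).mul ((((hP i l k₀ j).sub (hP k₀ l i j)).const_mul 2⁻¹).sub
    (IsBigOSmooth.finset_sum _ fun a _ ↦ IsBigOSmooth.finset_sum _ fun c _ ↦
      hKK j i c l k₀ a c a) |>.add
    (IsBigOSmooth.finset_sum _ fun a _ ↦ IsBigOSmooth.finset_sum _ fun c _ ↦
      hKK j k₀ c l i a c a))).mono (by linarith)

/-! ### The Ricci components of the end in its chart -/

/-- **The chart components of the Ricci tensor**: for `R < ‖y‖`, `ricciCoeff e D y` is the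
pullback `(Φ^* Ric)_y` of the Ricci form of `h` along the inverse chart `Φ = dataChart e` (so
`Ric_ij(y) = ricciCoeff e D y eᵢ eⱼ`); inside the closed ball `‖y‖ ≤ R` it is the junk value `0`.
Companion of `AFEnd.hCoeff` / `kCoeff` (`AsymptoticFlatness.lean`). Schoen–Yau 1979, p. 72–73
(the chart components of `t Ric` in `ds²_t = ds² + t Ric`). [cite: SchoenYauPMT1979, §3 pp. 72–73] -/
def ricciCoeff [D.metric.HasLeviCivita] (y : E3) : E3 →L[ℝ] E3 →L[ℝ] ℝ :=
  if hy : e.R < ‖y‖ then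
    pullbackBilin (I := 𝓡 3) (I' := 𝓡 3) e.dataChart (fun x ↦ D.metric.ricciCLM x) ⟨y, hy⟩
  else 0

/-- Outside the ball, `ricciCoeff` is the pullback of `Ric` along the inverse chart. [folklore] -/
theorem ricciCoeff_of_lt [D.metric.HasLeviCivita] {y : E3} (hy : e.R < ‖y‖) :
    ricciCoeff e D y =
      pullbackBilin (I := 𝓡 3) (I' := 𝓡 3) e.dataChart (fun x ↦ D.metric.ricciCLM x) ⟨y, hy⟩ :=
  dif_pos hy

/-- Inside the closed ball, `ricciCoeff` is the junk value `0`. [folklore] -/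
theorem ricciCoeff_of_not_lt [D.metric.HasLeviCivita] {y : E3} (hy : ¬ e.R < ‖y‖) :
    ricciCoeff e D y = 0 :=
  dif_neg hy

/-- **The chart components of `Ric` are the Ricci components of the pulled-back metric**
(naturality, `ricci_comap_apply`): for `R < ‖y‖`,
`ricciCoeff e D y v w = Ric^{Φ^*h}_y(v, w)`. [cite: ONeill1983, Ch. 3, Prop. 3.59] -/
theorem ricciCoeff_apply_eq_ricci_comap [D.metric.HasLeviCivita] {y : E3} (hy : e.R < ‖y‖)
    (v w : E3) :
    ricciCoeff e D y v w =
      (haveI := (D.metric.comap PseudoRiemannianMetric.contMDiff_pullbackBilin_holds e.dataChart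
        e.contMDiff_dataChart_succ e.injective_mfderiv_dataChart rfl).hasLeviCivita
      (D.metric.comap PseudoRiemannianMetric.contMDiff_pullbackBilin_holds e.dataChart
        e.contMDiff_dataChart_succ e.injective_mfderiv_dataChart rfl).ricci ⟨y, hy⟩ v w) := by
  haveI := (D.metric.comap PseudoRiemannianMetric.contMDiff_pullbackBilin_holds e.dataChart
    e.contMDiff_dataChart_succ e.injective_mfderiv_dataChart rfl).hasLeviCivita
  rw [ricciCoeff_of_lt e D hy]
  exact (D.metric.ricci_comap_apply PseudoRiemannianMetric.contMDiff_pullbackBilin_holds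
    e.contMDiff_dataChart_succ e.injective_mfderiv_dataChart rfl ⟨y, hy⟩ v w).symm

/-- **The chart components of `Ric` in an orthonormal frame are the coordinate expression**
(`OpensChart.ricci_eq_coord` for the pulled-back metric, whose representative is `hCoeff e D`):
for `R < ‖y‖`, `ricciCoeff e D y = ∑_{kl} Ric^coord_{kl}(y) · (bᵏ ⊗ bˡ)`. [cite: ONeill1983, Ch. 3, Lemma 3.38] -/
theorem ricciCoeff_eq_sum [D.metric.HasLeviCivita] {ι : Type*} [Fintype ι] [DecidableEq ι]
    (b : OrthonormalBasis ι ℝ E3) {y : E3} (hy : e.R < ‖y‖) :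
    ricciCoeff e D y = ∑ k₀, ∑ l,
      (∑ i, ∑ j, (Matrix.of fun i j ↦ hCoeff e D y (b i) (b j))⁻¹ j i *
        (2⁻¹ * (fderiv ℝ (fun y ↦ OpensChart.koszulForm (hCoeff e D) y (b l) (b k₀) (b j)) y (b i)
            - fderiv ℝ (fun y ↦ OpensChart.koszulForm (hCoeff e D) y (b l) (b i) (b j)) y (b k₀))
          - ∑ a, ∑ c, (Matrix.of fun i j ↦ hCoeff e D y (b i) (b j))⁻¹ c a *
              (2⁻¹ * OpensChart.koszulForm (hCoeff e D) y (b j) (b i) (b c)) *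
              (2⁻¹ * OpensChart.koszulForm (hCoeff e D) y (b l) (b k₀) (b a))
          + ∑ a, ∑ c, (Matrix.of fun i j ↦ hCoeff e D y (b i) (b j))⁻¹ c a *
              (2⁻¹ * OpensChart.koszulForm (hCoeff e D) y (b j) (b k₀) (b c)) *
              (2⁻¹ * OpensChart.koszulForm (hCoeff e D) y (b l) (b i) (b a)))) •
      bilinBasis b.toBasis k₀ l := by
  set g' := D.metric.comap PseudoRiemannianMetric.contMDiff_pullbackBilin_holds e.dataChart
    e.contMDiff_dataChart_succ e.injective_mfderiv_dataChart rfl with hg'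
  haveI := g'.hasLeviCivita
  set x₀ : exteriorRegion e.R := ⟨y, hy⟩ with hx₀
  set β' : Module.Basis ι ℝ (TangentSpace 𝓘(ℝ, E3) x₀) := b.toBasis with hβ'
  rw [eq_sum_smul_bilinBasis b.toBasis (ricciCoeff e D y)]
  refine Finset.sum_congr rfl fun k₀ _ ↦ Finset.sum_congr rfl fun l _ ↦ ?_
  congr 1
  have h1 : ricciCoeff e D y (b.toBasis k₀) (b.toBasis l) = g'.ricci x₀ (β' k₀) (β' l) :=
    e.ricciCoeff_apply_eq_ricci_comap D hy _ _
  rw [h1, OpensChart.ricci_eq_coord (e.val_comap_dataChart D) x₀ β' k₀ l]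
  rfl

/-- **`Ric` is `O₂(r^{−β−2})` in the chart** (indeed `O_k` if `h − δ ∈ O_{k+2}(r^{−β})`, `β > 0`):
the chart components `ricciCoeff e D` form a smooth symbol of order `−β − 2` (the coordinate
components `isBigOSmooth_ricciSum` times the constant forms `bᵏ ⊗ bˡ`, `ricciCoeff_eq_sum` far
out). Schoen–Yau 1979, p. 73. [cite: SchoenYauPMT1979, §3 p. 73] -/
theorem isBigOSmooth_ricciCoeff [D.metric.HasLeviCivita]
    (hH : IsBigOSmooth (k + 2) (-β) fun y ↦ hCoeff e D y - (innerSL ℝ : E3 →L[ℝ] E3 →L[ℝ] ℝ))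
    (hβ : 0 < β) : IsBigOSmooth k (-β - 2) (ricciCoeff e D) := by
  set b := EuclideanSpace.basisFun (Fin 3) ℝ with hb
  have h := IsBigOSmooth.finset_sum (Finset.univ : Finset (Fin 3)) fun k₀ _ ↦
    IsBigOSmooth.finset_sum (Finset.univ : Finset (Fin 3)) fun l _ ↦
      (e.isBigOSmooth_ricciSum D b hH hβ k₀ l).smul_const (bilinBasis b.toBasis k₀ l)
  exact h.congr_far (R₁ := e.R) fun y hy ↦ (e.ricciCoeff_eq_sum D b hy).symm

/-! ### The chart components of `ds² + t Ric` and their decay -/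

/-- **The chart components of the Ricci variation**: if the metric of `D₂` is `h + t Ric(h)`
pointwise, then `hCoeff e D₂ = hCoeff e D + t · ricciCoeff e D` (both sides are pullbacks along
the same inverse chart; inside the ball both junk values are `δ`). Schoen–Yau 1979, p. 72.
[cite: SchoenYauPMT1979, §3 p. 72] -/
theorem hCoeff_eq_add_ricciCoeff [D.metric.HasLeviCivita] {D₂ : InitialDataSet (𝓡 3) X} {t : ℝ}
    (hD₂ : ∀ (x : X) (v w : TangentSpace (𝓡 3) x),
      D₂.metric.val x v w = D.metric.val x v w + t * D.metric.ricci x v w) (y : E3) :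
    hCoeff e D₂ y = hCoeff e D y + t • ricciCoeff e D y := by
  by_cases hy : e.R < ‖y‖
  · rw [hCoeff_of_lt D₂ hy, hCoeff_of_lt D hy, ricciCoeff_of_lt e D hy]
    ext v w
    exact hD₂ _ _ _
  · unfold hCoeff
    rw [dif_neg hy, dif_neg hy, ricciCoeff_of_not_lt e D hy, smul_zero, add_zero]

/-- **`ds² + t Ric` is asymptotically flat to second order with mass `0`** (Schoen–Yau 1979,
p. 73: "For `t` sufficiently small, `ds²_t` is asymptotically flat by (1.2)"): if
`h − δ = o₅(r⁻²)` on the end (`IsStronglyAsymptoticallyFlatWith e D 0 2 0 5 0`) and the metric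
of `D₂` is `h + t Ric(h)` pointwise, then `hCoeff e D₂ − δ = (hCoeff e D − δ) + t · ricciCoeff e D`
is a symbol in `O₂(r⁻²)` (`ricciCoeff ∈ O₃(r⁻⁴)`), i.e. `IsAsymptoticallySchwarzschild e D₂ 0 2`
— for every real `t`. [cite: SchoenYauPMT1979, §3 p. 73] -/
theorem isAsymptoticallySchwarzschild_of_metric_eq_add_ricci [D.metric.HasLeviCivita]
    (haf : IsStronglyAsymptoticallyFlatWith e D 0 2 0 5 0) {D₂ : InitialDataSet (𝓡 3) X} {t : ℝ}
    (hD₂ : ∀ (x : X) (v w : TangentSpace (𝓡 3) x),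
      D₂.metric.val x v w = D.metric.val x v w + t * D.metric.ricci x v w) :
    IsAsymptoticallySchwarzschild e D₂ 0 2 := by
  have hH : IsBigOSmooth 5 (-2) fun y ↦ hCoeff e D y - (innerSL ℝ : E3 →L[ℝ] E3 →L[ℝ] ℝ) :=
    e.isBigOSmooth_hCoeff_sub_innerSL D haf
  have hRic : IsBigOSmooth 3 (-2 - 2) (ricciCoeff e D) :=
    e.isBigOSmooth_ricciCoeff D (k := 3) (β := 2) hH two_pos
  have hsum : IsBigOSmooth 2 (-2) fun y ↦
      (hCoeff e D y - (innerSL ℝ : E3 →L[ℝ] E3 →L[ℝ] ℝ)) + t • ricciCoeff e D y :=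
    (hH.of_le (by norm_num)).add (((hRic.mono (by norm_num)).of_le (by norm_num)).const_smul t)
  have hF : IsBigOSmooth 2 (-2) fun y ↦ hCoeff e D₂ y -
      (1 + (0 : ℝ) / (2 * ‖y‖)) ^ 4 • (innerSL ℝ : E3 →L[ℝ] E3 →L[ℝ] ℝ) := by
    refine hsum.congr fun y ↦ ?_
    rw [e.hCoeff_eq_add_ricciCoeff D hD₂ y, zero_div, add_zero, one_pow, one_smul]
    abel
  intro m hm
  exact hF.isBigO hm

end AFEnd

/-! ### `ds² + t Ric` is asymptotically flat, for families of data -/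

/-- **Step `ha` of the Ricci variation, proved**: every family of data `D_t`, `|t| < τ`, with
metric `h + t Ric(h)` on a strongly asymptotically flat end is asymptotically Schwarzschildean of
mass `0` to second order (the family form of `isAsymptoticallySchwarzschild_of_metric_eq_add_ricci`;
the hypotheses `e.IsSoleEnd`, `0 < τ` are those of the family and are not used).
Schoen–Yau 1979, p. 73. [cite: SchoenYauPMT1979, §3 p. 73] -/
theorem ricciVariation_isAsymptoticallySchwarzschild
    (X : Type) [TopologicalSpace X] [ChartedSpace E3 X] [IsManifold (𝓡 3) ∞ X] [T2Space X]
    [SecondCountableTopology X] [ConnectedSpace X]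
    (D : InitialDataSet (𝓡 3) X) [D.metric.HasLeviCivita] (e : AFEnd X) (τ : ℝ)
    (Dt : ℝ → InitialDataSet (𝓡 3) X)
    (haf : e.IsStronglyAsymptoticallyFlatWith D 0 2 0 5 0) (_hsole : e.IsSoleEnd) (_hτ : 0 < τ)
    (hDt : ∀ t : ℝ, |t| < τ → ∀ (x : X) (v w : TangentSpace (𝓡 3) x),
      (Dt t).metric.val x v w = D.metric.val x v w + t * D.metric.ricci x v w)
    (t : ℝ) (ht : |t| < τ) : IsAsymptoticallySchwarzschild e (Dt t) 0 2 :=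
  e.isAsymptoticallySchwarzschild_of_metric_eq_add_ricci D haf (hDt t ht)

end Literature.Geometry.Lorentzian

end
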